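import Mathlib
import HarnessLib
import HarnessLib.Audit
import Literature.NumberTheory.LFunctions.RiemannXi

/-!
# Jensen polynomials of ξ — the LOG-BAND leaf J-P(P3) (statement only)

Cell rh-jensen (human ruling D-0040, ladder RH column JENSEN, rung J-P(P3) «complement region / LOG BAND»;
label «closes rung J-P(P3)», proof-of-data, never summit credit; RH-FREE).

The column's large-shift ranges so far: `∃ N(d)` (GORZ 2019) → `c·e^d` (GORTTW) → `2d³` (J-P(P1′),
`JensenCubicRangeTwo`, proved) → `20·√d·log n ≤ n` (J-P(P1″), `JensenSqrtLogRangeTwenty`, proved). This file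
declares the next rung's LEAF: hyperbolicity of `J^{d,n}_γ` on a LOGARITHMIC band `n ≥ C·log(d+1)` for every rate
`C > 1/8`, from some shift `n₁(C)` on. The threshold `1/8` is the typed obstruction of the cell's idea-1 seat
(TRANSFER-LENS-5: rate `C ↔` window abscissa `σ₀ = ½ + 4C` of the arc/saddle transform; `C > 1/8 ⇔ σ₀ > 1`,
where ζ is a convergent Dirichlet series — RH-free; `C ≤ 1/8` would be quasi-RH re-indexed and is NOT claimed).

WHAT THIS IS NOT: nothing here bears on the zeros of ζ off the critical line or the truth of RH. Under RH every
`J^{d,n}_γ` is hyperbolic (Pólya), so RH implies this statement trivially; the converse inference is barred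
(`Literature.Barriers.RiemannHypothesis.JensenPolynomials`, Farmer 2022): a hyperbolicity range with `N(d) → ∞`
— here `N(d) ≍ log d` — carries no information on RH.

Statement only (`def … : Prop`); no `sorry`, no facts, no instances, no notation.
-/

set_option linter.dupNamespace false

namespace Summit.RiemannHypothesis.RiemannHypothesis.Theorems.JensenPolynomials

open Literature.NumberTheory.LFunctions Polynomial

/-- **RH-FREE. LOG BAND above rate 1/8: for every `C > 1/8` there is a shift `n₁` such that `J^{d,n}_γ` is
hyperbolic whenever `n ≥ n₁` and `C·log(d+1) ≤ n`** (so `N(d) ≤ max(n₁(C), C·log(d+1))`: the degree range at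
shift `n` is EXPONENTIAL, `d + 1 ≤ e^{n/C}`, against the polynomial `d ≤ (n/(20 log n))²` of J-P(P1″)). The
threshold `n₁(C)` is left existential on purpose (the mechanism's constants are asymptotic); `C ≤ 1/8` is not
claimed (quasi-RH re-indexed). -/
@[conjecture] def JensenLogBandEighth : Prop :=
  ∀ C : ℝ, 1 / 8 < C → ∃ n₁ : ℕ, ∀ d n : ℕ, n₁ ≤ n → C * Real.log ((d : ℝ) + 1) ≤ (n : ℝ) →
    (jensenPoly xiTaylorCoeff d n).Splits

end Summit.RiemannHypothesis.RiemannHypothesis.Theorems.JensenPolynomials
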